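import Literature.Analysis.FluidPDE.PineauVicolEnstrophy
import Literature.Analysis.FluidPDE.AxisymmetricVorticityTransport
import Literature.Analysis.FluidPDE.ClassicalSolutionCalculus
import Mathlib.MeasureTheory.Measure.Haar.InnerProductSpace
import HarnessLib

/-!
# The time term of the enstrophy identity over a twisted period (Pineau–Vicol 2026, §7.5)

Analysis/FluidPDE support file (all results proved; no named facts), sequel of
`PineauVicolEnstrophy` in the discharge programme of
`Literature.Analysis.FluidPDE.pineauVicol2026_rdss_liouville` (B. Pineau, V. Vicol,
arXiv:2607.09619 (2026), Thm. 1.7). The absorption theorem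
`PineauVicol2026.curl_eq_zero_of_small_local_enstrophy` there takes as input the vanishing of
`∫₀^S ∫ ⟪∂ₛΩ, Ω⟫` over a period ("the periodicity in time of Ω", §7.5 of the source). In the
rotation-free Leray frame the profile is only *twisted*-periodic, `V(S) = R_θ V(0) R_{−θ}`
(`PineauVicolRDSSLeray.exists_isBackwardLeraySolutionOn_of_rdss`), which suffices:

* `curl_rotZ_conj`: `curl (R_θ W R_{−θ}) = R_θ (curl W) R_{−θ}` (chain rule + the tree's
  algebraic equivariance `curlCLM_rotZL_conj`);
* `intervalIntegral_integral_inner_timeDeriv_vorticity_eq_zero`: for a classical solution of the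
  backward Leray system with `V(S) = R_θ V(0) R_{−θ}`, `|Ω(0)|², |Ω(S)|² ∈ L¹` and a uniform
  integrable dominator of `⟪∂ₛΩ, Ω⟫` on `[0, S]`:
  `∫₀^S ∫ ⟪∂ₛΩ, Ω⟫ dy ds = ½(‖Ω(S)‖₂² − ‖Ω(0)‖₂²) = 0` (Fubini, the fundamental theorem of
  calculus in `s`, equivariance of the curl and rotation invariance of Lebesgue measure).

## References

* B. Pineau, V. Vicol, arXiv:2607.09619 (2026), §7.5 (proof of Thm. 1.7, "using the periodicity
  in time of Ω"), (7.12). [PineauVicol2026]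
-/

noncomputable section

open MeasureTheory TopologicalSpace Set Function Filter Topology InnerProductSpace Real
open scoped RealInnerProductSpace ENNReal NNReal ContDiff

namespace Literature.Analysis.FluidPDE

namespace PineauVicol2026

/-- Local notation for physical space `ℝ³ = EuclideanSpace ℝ (Fin 3)`. -/
local notation "ℝ³" => EuclideanSpace ℝ (Fin 3)

/-- **Curl is equivariant under rotations about the axis**: for a differentiable field `W`,
`curl (R_θ W R_{−θ}) (y) = R_θ (curl W)(R_{−θ} y)` (chain rule and the algebraic equivariance
`curlCLM_rotZL_conj`). [folklore] -/
theorem curl_rotZ_conj {W : ℝ³ → ℝ³} (hW : Differentiable ℝ W) (θ : ℝ) (y : ℝ³) :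
    curl (fun z => rotZ θ (W (rotZ (-θ) z))) y = rotZ θ (curl W (rotZ (-θ) y)) := by
  have e : (fun z => rotZ θ (W (rotZ (-θ) z))) = (rotZL θ) ∘ W ∘ (rotZL (-θ)) := by
    funext z; simp [Function.comp]
  have h1 : DifferentiableAt ℝ (W ∘ (rotZL (-θ))) y :=
    (hW _).comp y (rotZL (-θ)).differentiableAt
  have hd : fderiv ℝ (fun z => rotZ θ (W (rotZ (-θ) z))) y =
      (rotZL θ).comp ((fderiv ℝ W (rotZ (-θ) y)).comp (rotZL (-θ))) := by
    rw [e, fderiv_comp y (rotZL θ).differentiableAt h1, ContinuousLinearMap.fderiv,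
      fderiv_comp y (hW _) (rotZL (-θ)).differentiableAt, ContinuousLinearMap.fderiv]
    rfl
  rw [curl_eq_curlCLM, hd, curlCLM_rotZL_conj, ← curl_eq_curlCLM]

/-- A field smooth on the time set `univ` is jointly continuous. [folklore] -/
theorem continuous_uncurry_of_isSmoothSpaceTimeOn_univ {F' : Type*} [NormedAddCommGroup F'] [NormedSpace ℝ F']
    {e : ℝ → ℝ³ → F'} (he : IsSmoothSpaceTimeOn univ e) : Continuous fun z : ℝ × ℝ³ => e z.1 z.2 := by
  have := he.continuousOn
  rw [univ_prod_univ, continuousOn_univ] at this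
  exact this

/-- **The time term of the enstrophy identity vanishes over a twisted period.** For a classical
solution `(V, P)` of the backward Leray system on `ℝ × ℝ³` with `V(S) = R_θ V(0) R_{−θ}`
(`S ≥ 0`), `|Ω(0)|², |Ω(S)|² ∈ L¹` and a uniform integrable dominator of `⟪∂ₛΩ, Ω⟫` on `[0, S]`:
`∫₀^S ∫ ⟪∂ₛΩ, Ω⟫ dy ds = ½(‖Ω(S)‖₂² − ‖Ω(0)‖₂²) = 0` (Fubini, the fundamental theorem of calculus
in `s`, `Ω(S) = R_θ Ω(0) R_{−θ}` by the equivariance of the curl, and rotation invariance of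
Lebesgue measure). This is the input `htime` of `curl_eq_zero_of_small_local_enstrophy`; in the
source it is "the periodicity in time of Ω" (§7.5). [cite: PineauVicol2026, §7.5 (proof of Thm. 1.7)] -/
theorem intervalIntegral_integral_inner_timeDeriv_vorticity_eq_zero
    {V : ℝ → ℝ³ → ℝ³} {P : ℝ → ℝ³ → ℝ} (h : IsBackwardLeraySolutionOn univ 1 V P)
    {S θ : ℝ} (hS : 0 ≤ S) (hper : ∀ y, V S y = rotZ θ (V 0 (rotZ (-θ) y)))
    (hΩ0 : Integrable fun y => ‖curl (V 0) y‖ ^ 2) (hΩS : Integrable fun y => ‖curl (V S) y‖ ^ 2)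
    {g : ℝ³ → ℝ} (hg : Integrable g)
    (hdom : ∀ s ∈ Icc 0 S, ∀ y, |⟪timeDerivWithin univ (vorticity V) s y, curl (V s) y⟫| ≤ g y) :
    ∫ s in (0 : ℝ)..S, (∫ y, ⟪timeDerivWithin univ (vorticity V) s y, curl (V s) y⟫) = 0 := by
  -- smoothness and joint continuity
  have hsm : IsSmoothSpaceTimeOn univ V := h.smooth_velocity
  have hΩsm : IsSmoothSpaceTimeOn univ (vorticity V) := hsm.isSmoothSpaceTimeOn_vorticity uniqueDiffOn_univ
  have hTsm : IsSmoothSpaceTimeOn univ (timeDerivWithin univ (vorticity V)) := hΩsm.timeDerivWithin uniqueDiffOn_univ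
  have hΩc := continuous_uncurry_of_isSmoothSpaceTimeOn_univ hΩsm
  have hTc := continuous_uncurry_of_isSmoothSpaceTimeOn_univ hTsm
  set f : ℝ → ℝ³ → ℝ := fun s y => ⟪timeDerivWithin univ (vorticity V) s y, curl (V s) y⟫ with hf
  have hfc : Continuous (uncurry f) := by
    have : uncurry f = fun z : ℝ × ℝ³ => ⟪timeDerivWithin univ (vorticity V) z.1 z.2, vorticity V z.1 z.2⟫ := by
      funext z; simp [hf, uncurry, vorticity_apply]
    rw [this]; exact hTc.inner hΩc
  -- integrability on `(0, S] × ℝ³`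
  set μ : Measure ℝ := volume.restrict (Ioc 0 S) with hμ
  have hfin : volume (Ioc (0 : ℝ) S) < ⊤ := measure_Ioc_lt_top
  have h1i : Integrable (fun _ : ℝ => (1 : ℝ)) μ := by
    have : IntegrableOn (fun _ : ℝ => (1 : ℝ)) (Ioc 0 S) (volume : Measure ℝ) := integrableOn_const hfin.ne
    rw [hμ]; exact this
  have hGi : Integrable (fun z : ℝ × ℝ³ => (1 : ℝ) * g z.2) (μ.prod (volume : Measure ℝ³)) := h1i.mul_prod hg
  have hae : ∀ᵐ z ∂(μ.prod (volume : Measure ℝ³)), z.1 ∈ Ioc (0 : ℝ) S := by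
    have hnull : (μ.prod (volume : Measure ℝ³)) ((Ioc (0 : ℝ) S)ᶜ ×ˢ (univ : Set ℝ³)) = 0 := by
      rw [Measure.prod_prod, hμ, Measure.restrict_apply (measurableSet_Ioc.compl), compl_inter_self,
        measure_empty, zero_mul]
    rw [ae_iff]
    refine measure_mono_null (fun z hz => ?_) hnull
    exact ⟨hz, mem_univ _⟩
  have hFi : Integrable (uncurry f) (μ.prod (volume : Measure ℝ³)) := by
    refine hGi.mono' hfc.aestronglyMeasurable (hae.mono fun z hz => ?_)
    rw [one_mul, Real.norm_eq_abs]
    exact hdom z.1 (Ioc_subset_Icc_self hz) z.2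
  -- Fubini
  have hswap := integral_integral_swap hFi
  rw [intervalIntegral.integral_of_le hS]
  show ∫ s, (∫ y, f s y) ∂μ = 0
  rw [hswap]
  -- the fundamental theorem of calculus in `s`, pointwise in `y`
  have hFTC : ∀ y, ∫ s, f s y ∂μ = (1 / 2) * ‖curl (V S) y‖ ^ 2 - (1 / 2) * ‖curl (V 0) y‖ ^ 2 := by
    intro y
    rw [hμ, ← intervalIntegral.integral_of_le hS]
    have hderiv : ∀ s ∈ uIcc (0 : ℝ) S, HasDerivAt (fun s => (1 / 2) * ‖vorticity V s y‖ ^ 2) (f s y) s := by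
      intro s _
      have h1 : HasDerivAt (fun s => vorticity V s y) (timeDerivWithin univ (vorticity V) s y) s :=
        hasDerivWithinAt_univ.1 (hΩsm.hasDerivWithinAt_timeDerivWithin uniqueDiffOn_univ (mem_univ s) y)
      have h2 := (h1.norm_sq).const_mul (1 / 2 : ℝ)
      refine h2.congr_deriv ?_
      simp only [hf, vorticity_apply, real_inner_comm (curl (V s) y)]
      ring
    have hint : IntervalIntegrable (fun s => f s y) volume 0 S :=
      (hfc.comp (continuous_id.prodMk continuous_const)).intervalIntegrable _ _
    have := intervalIntegral.integral_eq_sub_of_hasDerivAt hderiv hint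
    rw [this]
    simp [vorticity_apply]
  rw [integral_congr_ae (Eventually.of_forall hFTC)]
  -- `‖Ω(S)‖₂ = ‖Ω(0)‖₂` by rotation invariance
  have hVS : V S = fun y => rotZ θ (V 0 (rotZ (-θ) y)) := funext hper
  have hV0d : Differentiable ℝ (V 0) := (hsm.contDiff_slice (mem_univ 0)).differentiable (by simp)
  have hrot : ∀ y, ‖curl (V S) y‖ ^ 2 = ‖curl (V 0) (rotZ (-θ) y)‖ ^ 2 := fun y => by
    rw [hVS, curl_rotZ_conj hV0d, norm_rotZ]
  have hmp : MeasurePreserving (rotZLIE (-θ) : ℝ³ → ℝ³) volume volume := (rotZLIE (-θ)).measurePreserving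
  have hcomp : ∫ y, ‖curl (V 0) (rotZ (-θ) y)‖ ^ 2 = ∫ z, ‖curl (V 0) z‖ ^ 2 :=
    hmp.integral_comp (rotZLIE (-θ)).toHomeomorph.measurableEmbedding (fun z => ‖curl (V 0) z‖ ^ 2)
  have hSeq : ∫ y, ‖curl (V S) y‖ ^ 2 = ∫ z, ‖curl (V 0) z‖ ^ 2 := by
    rw [integral_congr_ae (Eventually.of_forall hrot)]; exact hcomp
  rw [integral_sub (hΩS.const_mul _) (hΩ0.const_mul _), integral_const_mul, integral_const_mul, hSeq, sub_self]

end PineauVicol2026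

end Literature.Analysis.FluidPDE
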